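import Mathlib
import Literature.Barriers.Schanuel.AlgebraicIndependenceOfLogarithmsStructuralRankProofs

/-!
# Route TwistedDetRank, crux `TdrPerNotQP` (stmt-ValiantsHypothesis-6284) — line `registered`
# (birth skeleton), stub `stub_conePowerRankThree`

**Statement.** Every cone product decomposition of the `m`-th tensor power of the sign character of
`𝔖_3`,
`∏_b sgn (π_b) = ∑_{t<r} ∏_b ∏_i u t b (π_b i) i` for all `π ∈ 𝔖_3^m`
(`û(σ) = ∏_i u (σ i) i` a point of the Birkhoff cone `Y_3 ⊂ ℂ^{𝔖_3}`), has length `r` with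
`3^m ≤ r · 2^m`; i.e. the Birkhoff-cone product rank of `sgn_3^{⊗m}` is at least `(3/2)^m`.

**Proof (a rank method that sees the equation of the cone).**  The cone `Y_3` lies on the cubic
`z_{id} z_{(012)} z_{(021)} = z_{(01)} z_{(02)} z_{(12)}` (both sides are the product of all nine
entries of `u`).  This cubic has the `3 × 3` linear determinantal representation
`L(z) = [[z_id, -z_(01), 0], [0, z_(012), z_(02)], [z_(12), 0, z_(021)]]`
(`det L(z) = z_{id} z_{(012)} z_{(021)} - z_{(01)} z_{(02)} z_{(12)}`), so `rank L(û) ≤ 2` for every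
cone point while `L(sgn) = [[1,1,0],[0,1,-1],[-1,0,1]]` has determinant `2`.  Writing
`L(z)[a,c] = ∑_σ z σ · Λ a c σ` with structure constants `Λ` (a `3 × 3` matrix of functions on
`𝔖_3`, a local notation below — the file introduces no definitions), the `m`-fold map
`F ↦ M_F`, `M_F[a, c] = ∑_π F(π) ∏_j Λ (a j) (c j) (π j)` is linear and sends a product function
`π ↦ ∏_j f_j(π_j)` to the Kronecker power `⊗_j L(f_j)` (the matrix `(a, c) ↦ ∏_j L(f_j)[a j, c j]`
indexed by functions `Fin m → Fin 3`).  Applied to the decomposition: the left side `L(sgn)^{⊗m}`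
is invertible (rank `3^m`); each summand `⊗_j L(û_{t,j})` has rank `≤ ∏_j rank L(û_{t,j}) ≤ 2^m`
(rank factorisation of every factor and the mixed-product rule); rank is subadditive.
-/

-- the mandated summit-side namespace repeats a component by design (single-problem summit)
set_option linter.dupNamespace false

namespace Summit.ValiantsHypothesis.ValiantsHypothesis.Theorems.TwistedDetRankTdrPerNotQP

open Matrix Finset

/-! ## Generic linear algebra: rank factorisation and Kronecker powers indexed by functions -/

section LinearAlgebra

variable {K : Type*} [Field K]

/-- Rank factorisation: a matrix of rank `ρ` is a product `P * Q` through `Fin ρ`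
(columns of `P` = a basis of the column space, `Q` = coordinates of the columns of `A`). -/
theorem conePowerRankThree_exists_mul_eq {m n : Type*} [Fintype m] [Fintype n] [DecidableEq n]
    (A : Matrix m n K) :
    ∃ (P : Matrix m (Fin A.rank) K) (Q : Matrix (Fin A.rank) n K), P * Q = A := by
  set W : Submodule K (m → K) := LinearMap.range A.mulVecLin
  let b : Module.Basis (Fin A.rank) K W := Module.finBasisOfFinrankEq K W rfl
  have hcol : ∀ j, A.col j ∈ W := fun j =>
    ⟨Pi.single j 1, by rw [Matrix.mulVecLin_apply, Matrix.mulVec_single_one]⟩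
  refine ⟨Matrix.of fun i l => (b l : m → K) i, Matrix.of fun l j => b.repr ⟨A.col j, hcol j⟩ l, ?_⟩
  ext i j
  have h := congrArg (fun w : W => (w : m → K) i) (b.sum_repr ⟨A.col j, hcol j⟩)
  simp only [Submodule.coe_sum, Submodule.coe_smul, Finset.sum_apply, Pi.smul_apply,
    smul_eq_mul] at h
  rw [Matrix.mul_apply]
  simp only [Matrix.of_apply]
  rw [show A i j = A.col j i from rfl, ← h]
  exact Finset.sum_congr rfl fun l _ => mul_comm _ _

/-- Rank of a finite sum of matrices is at most the sum of the ranks. -/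
theorem conePowerRankThree_rank_sum_le {m n ι : Type*} [Fintype m] [Fintype n]
    (s : Finset ι) (A : ι → Matrix m n K) :
    (∑ t ∈ s, A t).rank ≤ ∑ t ∈ s, (A t).rank := by
  classical
  induction s using Finset.induction_on with
  | empty => simp
  | insert a s ha ih =>
    rw [Finset.sum_insert ha, Finset.sum_insert ha]
    exact (Literature.Barriers.Schanuel.rank_add_le_rank_add_rank _ _).trans
      (Nat.add_le_add_left ih _)

/-- Mixed-product rule for Kronecker powers indexed by (dependent) functions,
`(⊗_j A_j) (⊗_j B_j) = ⊗_j (A_j B_j)`, the Kronecker power of a family `A` being the matrix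
`(a, c) ↦ ∏_j A j (a j) (c j)`. -/
theorem conePowerRankThree_kron_mul {ι : Type*} [Fintype ι] [DecidableEq ι] {α β γ : ι → Type*}
    [∀ j, Fintype (β j)] (A : ∀ j, Matrix (α j) (β j) K) (B : ∀ j, Matrix (β j) (γ j) K) :
    (Matrix.of fun (a : ∀ j, α j) (e : ∀ j, β j) => ∏ j, A j (a j) (e j)) *
        (Matrix.of fun (e : ∀ j, β j) (c : ∀ j, γ j) => ∏ j, B j (e j) (c j)) =
      Matrix.of fun (a : ∀ j, α j) (c : ∀ j, γ j) => ∏ j, (A j * B j) (a j) (c j) := by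
  ext a c
  simp only [Matrix.mul_apply, Matrix.of_apply]
  rw [Fintype.prod_sum]
  exact Finset.sum_congr rfl fun e _ => (Finset.prod_mul_distrib).symm

/-- The Kronecker power of identity matrices is the identity. -/
theorem conePowerRankThree_kron_one {ι : Type*} [Fintype ι] {α : ι → Type*}
    [∀ j, DecidableEq (α j)] :
    (Matrix.of fun (a c : ∀ j, α j) => ∏ j, (1 : Matrix (α j) (α j) K) (a j) (c j)) = 1 := by
  ext a c
  simp only [Matrix.of_apply, Matrix.one_apply]
  rw [Fintype.prod_boole]
  simp [funext_iff]

/-- The rank of a Kronecker power is at most the product of the ranks of the factors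
(rank factorisation of each factor and the mixed-product rule: it factors through
`∀ j, Fin (rank (A j))`). -/
theorem conePowerRankThree_rank_kron_le {ι : Type*} [Fintype ι] [DecidableEq ι]
    {α β : ι → Type*} [∀ j, Fintype (α j)] [∀ j, Fintype (β j)] [∀ j, DecidableEq (β j)]
    (A : ∀ j, Matrix (α j) (β j) K) :
    (Matrix.of fun (a : ∀ j, α j) (c : ∀ j, β j) => ∏ j, A j (a j) (c j)).rank ≤
      ∏ j, (A j).rank := by
  choose P Q hPQ using fun j => conePowerRankThree_exists_mul_eq (A j)
  have h : (Matrix.of fun (a : ∀ j, α j) (c : ∀ j, β j) => ∏ j, A j (a j) (c j)) =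
      (Matrix.of fun (a : ∀ j, α j) (e : ∀ j, Fin (A j).rank) => ∏ j, P j (a j) (e j)) *
        Matrix.of fun (e : ∀ j, Fin (A j).rank) (c : ∀ j, β j) => ∏ j, Q j (e j) (c j) := by
    rw [conePowerRankThree_kron_mul]
    simp_rw [hPQ]
  rw [h]
  refine (Matrix.rank_mul_le_left _ _).trans ((Matrix.rank_le_card_width _).trans ?_)
  simp

/-- A Kronecker power of invertible square matrices has full rank. -/
theorem conePowerRankThree_rank_kron_of_mul_eq_one {ι : Type*} [Fintype ι] [DecidableEq ι]
    {α : ι → Type*} [∀ j, Fintype (α j)] [∀ j, DecidableEq (α j)]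
    (A B : ∀ j, Matrix (α j) (α j) K) (h : ∀ j, A j * B j = 1) :
    (Matrix.of fun (a c : ∀ j, α j) => ∏ j, A j (a j) (c j)).rank = Fintype.card (∀ j, α j) := by
  apply le_antisymm (Matrix.rank_le_card_width _)
  have hmul : (Matrix.of fun (a c : ∀ j, α j) => ∏ j, A j (a j) (c j)) *
      (Matrix.of fun (a c : ∀ j, α j) => ∏ j, B j (a j) (c j)) = 1 := by
    rw [conePowerRankThree_kron_mul]
    simp_rw [h]
    exact conePowerRankThree_kron_one
  have := Matrix.rank_mul_le_left (Matrix.of fun (a c : ∀ j, α j) => ∏ j, A j (a j) (c j))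
    (Matrix.of fun (a c : ∀ j, α j) => ∏ j, B j (a j) (c j))
  rwa [hmul, Matrix.rank_one] at this

end LinearAlgebra

/-! ## The determinantal flattening of the Birkhoff cubic -/

/-- Structure constants `Λ` of the determinantal flattening `L(z)[a, c] = ∑_σ z σ · Λ a c σ`,
`L(z) = [[z_id, -z_(01), 0], [0, z_(012), z_(02)], [z_(12), 0, z_(021)]]`: a `3 × 3` matrix of
functions on `𝔖_3` (local notation only — no new definition is introduced). -/
local notation "Λ" =>
  (!![Pi.single 1 1, -Pi.single (Equiv.swap 0 1) 1, 0;
      0, Pi.single (finRotate 3) 1, Pi.single (Equiv.swap 0 2) 1;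
      Pi.single (Equiv.swap 1 2) 1, 0, Pi.single (finRotate 3)⁻¹ 1] :
    Matrix (Fin 3) (Fin 3) (Equiv.Perm (Fin 3) → ℂ))

/-- The flattening written out: `L(z) = [[z_id, -z_(01), 0], [0, z_(012), z_(02)], [z_(12), 0, z_(021)]]`. -/
theorem conePowerRankThree_flat_eq (z : Equiv.Perm (Fin 3) → ℂ) :
    (Matrix.of fun a c => ∑ σ, z σ * (Λ) a c σ) =
      !![z 1, -z (Equiv.swap 0 1), 0;
         0, z (finRotate 3), z (Equiv.swap 0 2);
         z (Equiv.swap 1 2), 0, z (finRotate 3)⁻¹] := by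
  ext a c
  fin_cases a <;> fin_cases c <;> simp [Pi.single_apply]

/-- The determinant of the flattening is the Birkhoff cubic
`z_{id} z_{(012)} z_{(021)} - z_{(01)} z_{(02)} z_{(12)}`. -/
theorem conePowerRankThree_det_flat (z : Equiv.Perm (Fin 3) → ℂ) :
    (Matrix.of fun a c => ∑ σ, z σ * (Λ) a c σ).det =
      z 1 * z (finRotate 3) * z (finRotate 3)⁻¹ -
        z (Equiv.swap 0 1) * z (Equiv.swap 0 2) * z (Equiv.swap 1 2) := by
  rw [conePowerRankThree_flat_eq, Matrix.det_fin_three]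
  simp
  ring

/-- The Birkhoff cubic vanishes on the cone: `det L(û) = 0` for `û(σ) = ∏_i u (σ i) i`
(both products of three permutation monomials equal the product of all nine entries of `u`). -/
theorem conePowerRankThree_det_flat_cone (z : Equiv.Perm (Fin 3) → ℂ)
    (u : Matrix (Fin 3) (Fin 3) ℂ) (hz : ∀ σ, z σ = ∏ i, u (σ i) i) :
    (Matrix.of fun a c => ∑ σ, z σ * (Λ) a c σ).det = 0 := by
  rw [conePowerRankThree_det_flat]
  simp only [hz, Fin.prod_univ_three]
  have h1 : (finRotate 3 : Equiv.Perm (Fin 3)) 0 = 1 := by decide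
  have h2 : (finRotate 3 : Equiv.Perm (Fin 3)) 1 = 2 := by decide
  have h3 : (finRotate 3 : Equiv.Perm (Fin 3)) 2 = 0 := by decide
  have h4 : ((finRotate 3)⁻¹ : Equiv.Perm (Fin 3)) 0 = 2 := by decide
  have h5 : ((finRotate 3)⁻¹ : Equiv.Perm (Fin 3)) 1 = 0 := by decide
  have h6 : ((finRotate 3)⁻¹ : Equiv.Perm (Fin 3)) 2 = 1 := by decide
  rw [h1, h2, h3, h4, h5, h6]
  simp [Equiv.swap_apply_of_ne_of_ne, Equiv.swap_apply_left, Equiv.swap_apply_right]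
  ring

/-- Hence the flattening of a cone point is singular: `rank L(û) ≤ 2`
(a kernel vector exists, rank–nullity). -/
theorem conePowerRankThree_rank_flat_cone_le (z : Equiv.Perm (Fin 3) → ℂ)
    (u : Matrix (Fin 3) (Fin 3) ℂ) (hz : ∀ σ, z σ = ∏ i, u (σ i) i) :
    (Matrix.of fun a c => ∑ σ, z σ * (Λ) a c σ).rank ≤ 2 := by
  set A : Matrix (Fin 3) (Fin 3) ℂ := Matrix.of fun a c => ∑ σ, z σ * (Λ) a c σ with hA
  obtain ⟨v, hv0, hv⟩ := Matrix.exists_mulVec_eq_zero_iff.2 (conePowerRankThree_det_flat_cone z u hz)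
  have hker : 1 ≤ Module.finrank ℂ (LinearMap.ker A.mulVecLin) := by
    rw [Nat.one_le_iff_ne_zero]
    intro h0
    have hbot : LinearMap.ker A.mulVecLin = ⊥ := Submodule.finrank_eq_zero.1 h0
    have : v ∈ LinearMap.ker A.mulVecLin := by
      rw [LinearMap.mem_ker, Matrix.mulVecLin_apply]; exact hv
    rw [hbot, Submodule.mem_bot] at this
    exact hv0 this
  have hrn := LinearMap.finrank_range_add_finrank_ker A.mulVecLin
  rw [Module.finrank_fin_fun] at hrn
  unfold Matrix.rank
  omega

/-- The flattening of the sign character has determinant `2`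
(`L(sgn) = [[1, 1, 0], [0, 1, -1], [-1, 0, 1]]`). -/
theorem conePowerRankThree_det_flat_sign :
    (Matrix.of fun a c =>
        ∑ σ, (fun τ : Equiv.Perm (Fin 3) => ((Equiv.Perm.sign τ : ℤ) : ℂ)) σ * (Λ) a c σ).det =
      2 := by
  rw [conePowerRankThree_det_flat]
  have h1 : Equiv.Perm.sign (finRotate 3 : Equiv.Perm (Fin 3)) = 1 := by decide
  have h2 : Equiv.Perm.sign ((finRotate 3)⁻¹ : Equiv.Perm (Fin 3)) = 1 := by decide
  have h3 : Equiv.Perm.sign (Equiv.swap (0 : Fin 3) 1) = -1 := by decide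
  have h4 : Equiv.Perm.sign (Equiv.swap (0 : Fin 3) 2) = -1 := by decide
  have h5 : Equiv.Perm.sign (Equiv.swap (1 : Fin 3) 2) = -1 := by decide
  simp only [h1, h2, h3, h4, h5, Equiv.Perm.sign_one]
  norm_num

/-- Hence `L(sgn) · L(sgn)⁻¹ = 1`. -/
theorem conePowerRankThree_flat_sign_mul_inv :
    (Matrix.of fun a c =>
        ∑ σ, (fun τ : Equiv.Perm (Fin 3) => ((Equiv.Perm.sign τ : ℤ) : ℂ)) σ * (Λ) a c σ) *
      (Matrix.of fun a c =>
        ∑ σ, (fun τ : Equiv.Perm (Fin 3) => ((Equiv.Perm.sign τ : ℤ) : ℂ)) σ * (Λ) a c σ)⁻¹ =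
      1 :=
  Matrix.mul_nonsing_inv _
    (by rw [conePowerRankThree_det_flat_sign]; exact isUnit_iff_ne_zero.2 two_ne_zero)

/-! ## The `m`-fold flattening `M_F[a, c] = ∑_π F(π) ∏_j Λ (a j) (c j) (π j)` -/

/-- `M_F` is additive: `M_{∑_t F_t} = ∑_t M_{F_t}` (stated with the sum as a hypothesis). -/
theorem conePowerRankThree_bigFlat_sum {m r : ℕ} (G : (Fin m → Equiv.Perm (Fin 3)) → ℂ)
    (F : Fin r → (Fin m → Equiv.Perm (Fin 3)) → ℂ) (hG : ∀ π, G π = ∑ t, F t π) :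
    (Matrix.of fun (a c : Fin m → Fin 3) =>
        ∑ π : Fin m → Equiv.Perm (Fin 3), G π * ∏ j, (Λ) (a j) (c j) (π j)) =
      ∑ t, Matrix.of fun (a c : Fin m → Fin 3) =>
        ∑ π : Fin m → Equiv.Perm (Fin 3), F t π * ∏ j, (Λ) (a j) (c j) (π j) := by
  ext a c
  simp only [Matrix.of_apply, Matrix.sum_apply, hG, Finset.sum_mul]
  rw [Finset.sum_comm]

/-- `M_F` of a product function `F(π) = ∏_j f_j(π_j)` is the Kronecker power of the flattenings
`L(f_j)` (stated with the product structure and the flattenings as hypotheses). -/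
theorem conePowerRankThree_bigFlat_prod {m : ℕ} (F : (Fin m → Equiv.Perm (Fin 3)) → ℂ)
    (f : Fin m → Equiv.Perm (Fin 3) → ℂ) (hF : ∀ π, F π = ∏ j, f j (π j))
    (A : Fin m → Matrix (Fin 3) (Fin 3) ℂ) (hA : ∀ j a c, A j a c = ∑ σ, f j σ * (Λ) a c σ) :
    (Matrix.of fun (a c : Fin m → Fin 3) =>
        ∑ π : Fin m → Equiv.Perm (Fin 3), F π * ∏ j, (Λ) (a j) (c j) (π j)) =
      Matrix.of fun (a c : Fin m → Fin 3) => ∏ j, A j (a j) (c j) := by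
  ext a c
  simp only [Matrix.of_apply, hF, hA, ← Finset.prod_mul_distrib]
  exact (Fintype.prod_sum fun j σ => f j σ * (Λ) (a j) (c j) σ).symm

/-! ## The stub -/

/-- **Stub `stub_conePowerRankThree`** of crux `TdrPerNotQP` (stmt-ValiantsHypothesis-6284), line
`registered`: the Birkhoff-cone product rank of `sgn_3^{⊗m}` is at least `(3/2)^m` — every cone
product decomposition `∏_b sgn π_b = ∑_{t<r} ∏_b ∏_i u t b (π_b i) i` on `𝔖_3^m` has
`3^m ≤ r · 2^m` (determinantal flattening of the Birkhoff cubic, Kronecker powers, subadditivity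
of rank). -/
theorem stub_conePowerRankThree :
    ∀ (m r : ℕ) (u : Fin r → Fin m → Matrix (Fin 3) (Fin 3) ℂ),
      (∀ π : Fin m → Equiv.Perm (Fin 3),
          ∑ t, ∏ b, ∏ i, u t b (π b i) i = ∏ b, ((Equiv.Perm.sign (π b) : ℤ) : ℂ)) →
        3 ^ m ≤ r * 2 ^ m := by
  intro m r u hu
  -- the flattening of the sign character and of the cone points `û_{t,j}`
  let S : Matrix (Fin 3) (Fin 3) ℂ := Matrix.of fun a c =>
    ∑ σ, (fun τ : Equiv.Perm (Fin 3) => ((Equiv.Perm.sign τ : ℤ) : ℂ)) σ * (Λ) a c σ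
  let T : Fin r → Fin m → Matrix (Fin 3) (Fin 3) ℂ := fun t j => Matrix.of fun a c =>
    ∑ σ, (fun τ : Equiv.Perm (Fin 3) => ∏ i, u t j (τ i) i) σ * (Λ) a c σ
  -- the `m`-fold flattening of both sides of the decomposition
  have hmat : (Matrix.of fun (a c : Fin m → Fin 3) => ∏ j, (fun _ : Fin m => S) j (a j) (c j)) =
      ∑ t, Matrix.of fun (a c : Fin m → Fin 3) => ∏ j, T t j (a j) (c j) := by
    rw [← conePowerRankThree_bigFlat_prod (fun π => ∏ j, ((Equiv.Perm.sign (π j) : ℤ) : ℂ))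
      (fun _ τ => ((Equiv.Perm.sign τ : ℤ) : ℂ)) (fun _ => rfl) (fun _ => S) (fun _ _ _ => rfl)]
    rw [conePowerRankThree_bigFlat_sum (fun π => ∏ j, ((Equiv.Perm.sign (π j) : ℤ) : ℂ))
      (fun t π => ∏ j, ∏ i, u t j (π j i) i) (fun π => (hu π).symm)]
    refine Finset.sum_congr rfl fun t _ => ?_
    exact conePowerRankThree_bigFlat_prod _ (fun j τ => ∏ i, u t j (τ i) i) (fun _ => rfl)
      (T t) (fun _ _ _ => rfl)
  -- left side: full rank `3^m`
  have hL : (Matrix.of fun (a c : Fin m → Fin 3) =>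
      ∏ j, (fun _ : Fin m => S) j (a j) (c j)).rank = 3 ^ m := by
    rw [conePowerRankThree_rank_kron_of_mul_eq_one (fun _ : Fin m => S) (fun _ => S⁻¹)
      fun _ => conePowerRankThree_flat_sign_mul_inv]
    simp
  -- right side: rank at most `r · 2^m`
  have hR : (∑ t, Matrix.of fun (a c : Fin m → Fin 3) => ∏ j, T t j (a j) (c j)).rank ≤
      r * 2 ^ m := by
    refine (conePowerRankThree_rank_sum_le _ _).trans ?_
    have hterm : ∀ t : Fin r,
        (Matrix.of fun (a c : Fin m → Fin 3) => ∏ j, T t j (a j) (c j)).rank ≤ 2 ^ m := by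
      intro t
      refine (conePowerRankThree_rank_kron_le (T t)).trans ?_
      calc ∏ j, (T t j).rank ≤ ∏ _j : Fin m, 2 :=
            Finset.prod_le_prod' fun j _ =>
              conePowerRankThree_rank_flat_cone_le _ (u t j) (fun _ => rfl)
        _ = 2 ^ m := by simp
    calc ∑ t, (Matrix.of fun (a c : Fin m → Fin 3) => ∏ j, T t j (a j) (c j)).rank
        ≤ ∑ _t : Fin r, 2 ^ m := Finset.sum_le_sum fun t _ => hterm t
      _ = r * 2 ^ m := by simp
  rw [← hL, hmat]
  exact hR

end Summit.ValiantsHypothesis.ValiantsHypothesis.Theorems.TwistedDetRankTdrPerNotQP
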